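import Literature.NumberTheory.GaloisCohomology.KolyvaginSystems
import Summits.BirchSwinnertonDyer.Rank1Residual.X11b.WeilTransport
import Literature.NumberTheory.EllipticCurves.LocalEulerCharacteristicTorsion
import Literature.NumberTheory.EllipticCurves.LocalWeilPairingDuality
import Literature.NumberTheory.EllipticCurves.ArchimedeanKummerImageMaximal
import HarnessLib

/-!
# Sakamoto's hypothesis "residually coisotropic" (JTNB 36 (2024) Def. 3.8) for every local
# condition on `E[n]` containing the Kummer condition — cell `b2b-bsdres`, team n1011,
# sub-target T-a3-F1 (hypothesis side of Sakamoto 2024 Thm. 4.4 at `p = 3`), deal R5-3 (p18)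

HONEST FRAMING (cell `b2b-bsdres`, run/shared/lean/b2b/bsd-rank1-residual/, verbatim in every
file): the goal of the cell is to DELETE the COMBINATION-SHAPED residual classes of the
Birch–Swinnerton-Dyer formula for ALL analytic-rank `≤ 1` elliptic curves over `ℚ` — "full BSD
formula for every rank `≤ 1` curve in class `C`" assembled STRICTLY from published theorems — so
that the rank-`≤ 1` remainder becomes exactly the CONSTRUCTION-SHAPED classes, which are TYPED
(missing-input `Prop`s), NOT attempted. This is not "finishing BSD". Team n1011 (N10/N11, the
additive block `X4 ∧ p = 3`): research route; no claim beyond the stated classes; the label X4 and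
the mark of RESIDUAL-MAP §I N11 are UNCHANGED by this file; nothing is booked. HYPOTHESIS-side
theorems only: no definition, no named fact is minted (the one arithmetic input that is not a
theorem of the tree, Tate's local Euler–Poincaré characteristic formula, is the tree's named fact
`Literature.NumberTheory.GaloisRepresentations.localEulerPoincareCharacteristic K_v`, carried as an
explicit hypothesis exactly as in `LocalEulerCharacteristicTorsion.lean`; no conclusion-side
consumer of Sakamoto's Thm. 4.4 is written here — referee-1 ruling T-a3-F1 O1, Stage 2b).

## What this file proves and why

R. Sakamoto, *The theory of Kolyvagin systems for `p = 3`*, JTNB 36 (2024) 919–946, Thm. 4.4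
asks the Selmer structure `𝓕` on `T` to be **residually coisotropic** (Def. 3.8, p. 924): for the
induced structure `𝓖 = 𝓕̄` on the residual representation `T̄` and the residual self-duality
`θ : T̄ ⥲ T̄^∨(1)` of (H.SD), `H¹_{𝓖^*}(K_v, T̄) ⊂ H¹_𝓖(K_v, T̄)` at every `v ∈ S(𝓕)` — in the tree
`LocalInvariants.IsResiduallyCoisotropicAt inv 𝓖 θ v` (`KolyvaginSystems.lean`, p252129: the dual
`𝓖^*` is the annihilator under the local Tate pairings `⟨a, b⟩_v = inv_v (a ∪ b)` of a family of
local invariant maps `inv`, transported back to `T̄` along `θ`).  For an elliptic curve `E = W`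
over a number field `K`, `T̄ = E[n]` (`n = p` in the source; here any prime power where counting
is needed) and `θ = w` the Weil dual map `E[n] → E[n]^∨(1) = Hom(E[n], μₙ)`, `T ↦ e(·, T)`
(`Literature.NumberTheory.EllipticCurves.weilDualIntertwining`), this file proves:

* **(Adjunction, every place — REUSED, not re-proved.)** `⟨a, w_* y⟩_v = inv_v (a ∪ₑ y)`: the
  local Tate pairing against a transported class is the local Weil cup product — the tree's
  `X11b.LocBridge.localTatePairingZMod_map_weilDual` (multr1-p2, `X11b/WeilTransport.lean`); here
  only its reading on Sakamoto's `dualTransported` (`mem_dualTransported_weilDual_iff`).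
* **(Right maximal isotropy of the local Kummer condition, finite places.)** For `y ∈ H¹(K_v, E[n])`:
  `(∀ a ∈ 𝓛_v, a ∪ₑ y = 0) ↔ y ∈ 𝓛_v`, `𝓛_v` the local Kummer condition (image of `E(K_v)/n`)
  — the mirror image of the tree's `forall_mem_kummerLocalConditionAt_weilCupProduct_eq_zero_iff`
  (LEFT argument), by the same counting lemma on the flipped pairing and the tree's right-kernel
  local duality; Milne, *ADT*, I Cor. 3.4 / Lemma 6.15, Poonen–Rains 2012 Prop. 4.10.  The count
  `#H¹(K_v, E[n]) ≤ (#𝓛_v)²` is Tate's local Euler characteristic (the named fact).  (The cell's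
  `X11b.KummerDuality.annRight_invWeilPairing_kummerSelmerStructure_inr` is the same fact at a finite
  place for `K : Type` in the `annRight`/`invWeilPairing` vocabulary of X11b; the version here is
  universe-polymorphic, over any non-archimedean local `K`-field, in the Literature vocabulary.)
* **(Coisotropy, MAIN.)** For EVERY local condition `𝓖_v` on `E[n]` CONTAINING the local Kummer
  condition, every family `inv` with `inv_v` injective on `H²(K_v, μₙ)` (e.g. the Poitou–Tate
  family, `LocalInvariants.IsPerfect`), at every finite place `v` (given the Euler characteristic
  at `v`): `w⁻¹(𝓖_v^*) ≤ 𝓖_v`, i.e. `inv.IsResiduallyCoisotropicAt 𝓖 w v`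
  (`isResiduallyCoisotropicAt_inr_of_kummer_le`).  Proof: duals reverse inclusions, so
  `w⁻¹(𝓖_v^*) ≤ w⁻¹(𝓛_v^*) = 𝓛_v ≤ 𝓖_v`.  At an infinite place and odd `n`, `H¹(K_w, E[n]) = 0`
  and there is nothing to prove (`isResiduallyCoisotropicAt_inl_of_odd`); whence
  `inv.IsResiduallyCoisotropic 𝓖 w S` for every finite set of places `S`
  (`isResiduallyCoisotropic_of_kummer_le`).  NO Tamagawa-number, reduction-type or local-torsion
  hypothesis enters: for Sakamoto's own structure of his §9 (unramified classes at bad `ℓ`) the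
  condition `3 ∤ c_ℓ` is needed (his Lemma 9.3), for any structure containing the Kummer = finite
  condition it is not — this is the kernel form of skeleton T-a3 v2 §6 (a) / `T-a3-S3-G1.md` §3.
* **(Instances.)** The induced ("residual") structures `𝓕̄` of Sakamoto's setting `T = E[p^m] ↠
  T̄ = E[p]` — Kim's classical structure, the finite-level propagated structures, anything between —
  contain the Kummer condition and are therefore residually coisotropic: sibling file
  `PropagatedConditionCoisotropicInduced.lean`.  The Mazur–Rubin `T_p`-propagated structure of
  skeleton T-a3 §6 is covered by `isResiduallyCoisotropic_of_kummer_le` the moment its local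
  conditions are known to contain the Kummer conditions (the `p`-adic divisible lift).
* **(Self-duality of the classical residual structure.)** `w⁻¹(𝓛_v^*) = 𝓛_v` at every finite
  place (`dualTransported_kummerSelmerStructure_inr`): the Kummer structure on `E[n]` is residually
  SELF-dual there, so no finite place `v ∤ ∞` is exceptional for it in the sense of Def. 3.9.

References: R. Sakamoto, JTNB 36 (2024) 919–946, §3.1.2, Def. 3.8, Def. 3.9, Thm. 4.4, Def. 9.2,
Lemma 9.3 [Sakamoto2024]; B. Mazur, K. Rubin, Mem. AMS 799 (2004) §3.7 [MazurRubin2004];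
C.-H. Kim, Amer. J. Math. 148 (2026) §2.1 [Kim2022StructureSelmer]; J. S. Milne, *Arithmetic
Duality Theorems* (2006) I Cor. 2.3, Thm. 2.8, Cor. 3.4, Lemma 6.15, §6 [MilneADT2006];
B. Poonen, E. Rains, JAMS 25 (2012) Prop. 4.10 [PoonenRains2012].
-/

noncomputable section

open scoped Classical

universe u

namespace Summit.BirchSwinnertonDyer.Rank1Residual.GaloisImage

open CategoryTheory WeierstrassCurve Field Function NumberField IsDedekindDomain
open Literature.NumberTheory.EllipticCurves Literature.NumberTheory.GaloisRepresentations
open Literature.NumberTheory.GaloisCohomology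
open Literature.NumberTheory.GaloisRepresentations.DiscreteGaloisModule (mu MuCarrier tateDual
  tateDualPairingLocal localTatePairing localTatePairingZMod SelmerStructure localMap)
open scoped ContRepresentation

-- Cup products need `LocallyCompactSpace Γ_F`; as in the tree's local-duality files, the
-- compactness of absolute Galois groups is a local instance only; so are the finiteness of `E[n]`
-- and of `μₙ` (needed to speak of the Tate dual `E[n]^∨(1)`).
attribute [local instance] absoluteGaloisGroup_compactSpace
attribute [local instance] finite_geomTorsion_of_neZero
  Literature.NumberTheory.EllipticCurves.finite_muCarrier

/-! ## Right maximal isotropy of the local Kummer condition over a local `K`-field -/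

section LocalField

variable {K : Type u} [Field K] [CharZero K] (W : WeierstrassCurve K) (n : ℕ) [NeZero n]
  [W.IsElliptic]
variable (e : geomTorsion W n → geomTorsion W n → AlgebraicClosure K)
  (hμ : ∀ S T, e S T ^ n = 1)
  (hadd₁ : ∀ S₁ S₂ T, e (S₁ + S₂) T = e S₁ T * e S₂ T)
  (hadd₂ : ∀ S T₁ T₂, e S (T₁ + T₂) = e S T₁ * e S T₂)
variable (F : Type u) [Field F] [Algebra K F] [CharZero F] [ValuativeRel F] [TopologicalSpace F]
  [IsNonarchimedeanLocalField F]

/-- **The local Kummer condition is its own RIGHT annihilator, given the Euler-characteristic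
count.**  For `e` a `Γ_K`-equivariant alternating non-degenerate biadditive `μₙ`-valued pairing on
`E[n]` (a Weil pairing), `F` a `K`-field which is a non-archimedean local field of characteristic
`0`, and `#H¹(F, E[n]) ≤ (#𝓛_F)²` (`𝓛_F = kummerLocalConditionAt W n F`): for `y ∈ H¹(F, E[n])`,

  `(∀ x ∈ 𝓛_F, x ∪ₑ y = 0) ↔ y ∈ 𝓛_F`.

The tree's `forall_mem_kummerLocalConditionAt_weilCupProduct_eq_zero_iff` is the same statement
with the roles of the two arguments exchanged; the proof is the same counting
(`forall_mem_apply_eq_zero_iff_of_isotropic_of_card_le`) applied to the FLIPPED `ℤ/n`-valued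
pairing `(y, x) ↦ ι(x ∪ₑ y)`, whose left adjoint is injective by the right-kernel local duality
`eq_zero_of_forall_weilCupProduct_eq_zero_right`, together with the isotropy of `𝓛_F`
(the discharged Poonen–Rains fact `kummerClass_cupProduct_kummerClass_eq_zero_holds`).
Milne, *ADT*, I Cor. 3.4 and Lemma 6.15; Poonen–Rains 2012, Prop. 4.10.
[cite: MilneADT2006, Ch. I, Cor. 3.4 and Lemma 6.15] [cite: PoonenRains2012, Prop. 4.10] -/
theorem forall_mem_kummerLocalConditionAt_weilCupProduct_eq_zero_right_iff
    (hgal : ∀ (σ : absoluteGaloisGroup K) (S T : geomTorsion W n), σ • e S T = e (σ • S) (σ • T))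
    (halt : ∀ T, e T T = 1) (hnondeg : ∀ T, (∀ S, e S T = 1) → T = 0)
    (hcard : Nat.card (galoisCohomology (GaloisRep.restrictField F (W.torsionGaloisModule n)) 1) ≤
      Nat.card (W.kummerLocalConditionAt n F) * Nat.card (W.kummerLocalConditionAt n F))
    (y : galoisCohomology (GaloisRep.restrictField F (W.torsionGaloisModule n)) 1) :
    (∀ x ∈ W.kummerLocalConditionAt n F, ((weilContPairing W n e hμ hadd₁ hadd₂ hgal).restrict
      (absGaloisRestrict K F)).cupProduct x y = 0) ↔ y ∈ W.kummerLocalConditionAt n F := by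
  have hnZ : (n : ℤ) ≠ 0 := Int.natCast_ne_zero.mpr (NeZero.ne n)
  haveI := finite_galoisCohomology_one_torsion_restrictField W n F
  -- isotropy of `𝓛_F` (the discharged Poonen–Rains fact over `F`)
  have hiso : ∀ x ∈ W.kummerLocalConditionAt n F, ∀ y ∈ W.kummerLocalConditionAt n F,
      ((weilContPairing W n e hμ hadd₁ hadd₂ hgal).restrict (absGaloisRestrict K F)).cupProduct x y
        = 0 :=
    fun x hx y hy => W.cupProduct_eq_zero_of_mem_kummerLocalConditionAt_of_fact n e hnZ
      (kummerClass_cupProduct_kummerClass_eq_zero_holds F) hμ hadd₁ hadd₂ halt hgal hx hy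
  refine ⟨fun hy => ?_, fun hy x hx => hiso x hx y hy⟩
  -- a `ℤ/n`-valued pairing `b(x, y) = ι(H²(μ-iso)(x ∪ₑ y))` refining the cup product
  obtain ⟨ι, hι, -, -⟩ := localDuality_bijective F
    (GaloisRep.restrictField F (W.torsionGaloisModule n) :
      ContinuousRep (absoluteGaloisGroup F) ℤ (geomTorsion W n))
    (fun T : geomTorsion W n => AddSubgroup.torsionBy.nsmul T)
  let inv : galoisCohomology (GaloisRep.restrictField F (mu K n)) 2 →+ ZMod n :=
    ι.comp (cohomologyMap (muRestrictIso K n F).hom 2).hom.toLinearMap.toAddMonoidHom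
  have hinv : Injective inv :=
    hι.comp (continuousCohomologyEquivOfIso (muRestrictIso K n F) 2).injective
  let P := (weilContPairing W n e hμ hadd₁ hadd₂ hgal).restrict (absGaloisRestrict K F)
  let b : galoisCohomology (GaloisRep.restrictField F (W.torsionGaloisModule n)) 1 →+
      galoisCohomology (GaloisRep.restrictField F (W.torsionGaloisModule n)) 1 →+ ZMod n :=
    AddMonoidHom.mk' (fun x => inv.comp (P.cupProduct x).toAddMonoidHom)
      fun x x' => AddMonoidHom.ext fun y => by
        change inv (P.cupProduct (x + x') y) = inv (P.cupProduct x y) + inv (P.cupProduct x' y)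
        exact (congrArg inv (DFunLike.congr_fun (map_add P.cupProduct x x') y)).trans
          (map_add inv _ _)
  have hb : ∀ x y, b x y = inv (P.cupProduct x y) := fun _ _ => rfl
  have hb' : ∀ y x, b.flip y x = inv (P.cupProduct x y) := fun y x => by
    rw [AddMonoidHom.flip_apply, hb]
  -- the FLIPPED pairing has injective left adjoint: right-kernel local duality
  have hbinj : Injective b.flip := by
    refine (injective_iff_map_eq_zero _).mpr fun y hy => ?_
    refine eq_zero_of_forall_weilCupProduct_eq_zero_right W n e hμ hadd₁ hadd₂ F hgal hnondeg y
      fun x => ?_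
    have h1 : inv (P.cupProduct x y) = 0 := by rw [← hb', hy, AddMonoidHom.zero_apply]
    exact hinv (h1.trans (map_zero inv).symm)
  have hH : ∀ y : galoisCohomology (GaloisRep.restrictField F (W.torsionGaloisModule n)) 1,
      n • y = 0 :=
    nsmul_continuousCohomology_one_eq_zero _ n (fun T : geomTorsion W n => AddSubgroup.torsionBy.nsmul T)
  refine (forall_mem_apply_eq_zero_iff_of_isotropic_of_card_le b.flip hH hbinj
    (W.kummerLocalConditionAt n F) (W.kummerLocalConditionAt n F)
    (fun y hy x hx => (hb' y x).trans ((congrArg inv (hiso x hx y hy)).trans (map_zero inv)))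
    hcard y).mp fun x hx => (hb' y x).trans ((congrArg inv (hy x hx)).trans (map_zero inv))

end LocalField

/-! ## Over a number field -/

section NumberField

variable {K : Type u} [Field K] [NumberField K] (W : WeierstrassCurve K) (n : ℕ) [NeZero n]
  [W.IsElliptic]
variable (e : geomTorsion W n → geomTorsion W n → AlgebraicClosure K)
  (hμ : ∀ S T, e S T ^ n = 1)
  (hadd₁ : ∀ S₁ S₂ T, e (S₁ + S₂) T = e S₁ T * e S₂ T)
  (hadd₂ : ∀ S T₁ T₂, e S (T₁ + T₂) = e S T₁ * e S T₂)
  (hgal : ∀ (σ : absoluteGaloisGroup K) (S T : geomTorsion W n), σ • e S T = e (σ • S) (σ • T))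

/-! ### Right maximal isotropy at a finite place, from the local Euler characteristic -/

/-- **Right maximal isotropy of the local Kummer condition at a finite place `v`, prime-power
level, from the local Euler–Poincaré characteristic**: for `y ∈ H¹(K_v, E[n])` (the local module
`(W.torsionGaloisModule n).toLocal (Sum.inr v)`, the local condition
`W.kummerSelmerStructure n (Sum.inr v)` and the local Weil pairing `weilContPairingLocal … (Sum.inr v)`
of `WeilPairingTateDual.lean`): `(∀ x ∈ 𝓛_v, x ∪ₑ y = 0) ↔ y ∈ 𝓛_v`.  The count is the tree's
`natCard_galoisCohomology_one_torsion_adicCompletion_eq_sq` (Milne I Thm. 2.8 for `E[n]`, from the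
named fact `localEulerPoincareCharacteristic K_v`) with `#𝓛_v = #E(K_v)[n] · #(𝓞_v/n)`
(`natCard_kummerLocalConditionAt_adicCompletion`, Milne I Lemma 3.3).
[cite: MilneADT2006, Ch. I, Cor. 3.4 and Lemma 6.15] [cite: PoonenRains2012, Prop. 4.10] -/
theorem forall_mem_kummerSelmerStructure_weilCupProduct_eq_zero_right_iff_inr_of_localEuler
    (halt : ∀ T, e T T = 1) (hnondeg : ∀ T, (∀ S, e S T = 1) → T = 0) (hn : IsPrimePow n)
    (v : HeightOneSpectrum (𝓞 K)) (hEP : localEulerPoincareCharacteristic (v.adicCompletion K))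
    (y : galoisCohomology ((W.torsionGaloisModule n).toLocal (Sum.inr v)) 1) :
    (∀ x ∈ W.kummerSelmerStructure n (Sum.inr v),
        (weilContPairingLocal W n e hμ hadd₁ hadd₂ hgal (Sum.inr v)).cupProduct x y = 0) ↔
      y ∈ W.kummerSelmerStructure n (Sum.inr v) := by
  haveI : CharZero (v.adicCompletion K) := charZero_adicCompletion v
  have hcard : Nat.card (galoisCohomology
        (GaloisRep.restrictField (v.adicCompletion K) (W.torsionGaloisModule n)) 1) ≤
      Nat.card (W.kummerLocalConditionAt n (v.adicCompletion K)) *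
        Nat.card (W.kummerLocalConditionAt n (v.adicCompletion K)) := by
    rw [natCard_galoisCohomology_one_torsion_adicCompletion_eq_sq W v n hn hEP, sq,
      W.natCard_kummerLocalConditionAt_adicCompletion v (NeZero.ne n)]
  have h := forall_mem_kummerLocalConditionAt_weilCupProduct_eq_zero_right_iff W n e hμ hadd₁ hadd₂
    (v.adicCompletion K) hgal halt hnondeg hcard
  exact h y

/-! ### Residual coisotropy (Sakamoto Def. 3.8) -/

/-- **Membership in Sakamoto's transported dual condition, through the Weil cup product**: for a
local condition `𝓖_v ≤ H¹(K_v, E[n])`, a family of local invariant maps `inv` and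
`y ∈ H¹(K_v, E[n])`: `y ∈ w⁻¹(𝓖_v^*)` iff `inv_v (a ∪ₑ y) = 0` for every `a ∈ 𝓖_v` — unfolding
`LocalInvariants.dualTransported` / `dualLocalCondition` (Sakamoto §3.1.2: "we regard `𝓕^*` as a
Selmer structure on `T̄`" via (H.SD)) and the adjunction `⟨a, w_* y⟩_v = inv_v (a ∪ₑ y)` of the
tree (`X11b.LocBridge.localTatePairingZMod_map_weilDual`: adjoint naturality of the cup product with
`e(S, T) = (w T)(S)`, Milne I §6 proof of Prop. 6.9). [cite: Sakamoto2024, §3.1.2 and Def. 3.8 (p. 924)] -/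
theorem mem_dualTransported_weilDual_iff (inv : LocalInvariants K n)
    (𝓖 : SelmerStructure (W.torsionGaloisModule n)) (v : Place K)
    (y : galoisCohomology ((W.torsionGaloisModule n).toLocal v) 1) :
    y ∈ inv.dualTransported 𝓖 (weilDualIntertwining W n e hμ hadd₁ hadd₂ hgal) v ↔
      ∀ a ∈ 𝓖 v, inv v ((weilContPairingLocal W n e hμ hadd₁ hadd₂ hgal v).cupProduct a y) = 0 := by
  rw [LocalInvariants.mem_dualTransported_iff, LocalInvariants.dualSelmerStructure_apply,
    LocalInvariants.mem_dualLocalCondition_iff]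
  refine forall₂_congr fun a _ => ?_
  rw [show localMap (weilDualIntertwining W n e hμ hadd₁ hadd₂ hgal) v y =
      galoisCohomology.map ((weilDualIntertwining W n e hμ hadd₁ hadd₂ hgal).restrictField
        (Place.Completion v)) 1 y from rfl,
    X11b.LocBridge.localTatePairingZMod_map_weilDual W n e hμ hadd₁ hadd₂ hgal v (inv v) a y]

/-- **MAIN LOCAL THEOREM (finite places). Every local condition containing the Kummer condition is
residually coisotropic.**  Let `v` be a finite place of the number field `K`, `n` a prime power,
`e` a Weil pairing on `E[n]` (alternating, non-degenerate, `Γ_K`-equivariant, `μₙ`-valued), `inv`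
a family of local invariant maps with `inv_v` injective on `H²(K_v, μₙ)` (e.g. the Poitou–Tate
family: `LocalInvariants.IsPerfect`), and assume Tate's local Euler–Poincaré characteristic formula
at `K_v` (the tree's named fact `localEulerPoincareCharacteristic`).  If the local condition
`𝓖_v ≤ H¹(K_v, E[n])` CONTAINS the local Kummer condition `𝓛_v` (the image of `E(K_v)/n`), then

  `w⁻¹(𝓖_v^*) ≤ 𝓖_v`,  i.e.  `inv.IsResiduallyCoisotropicAt 𝓖 w (Sum.inr v)`

(Sakamoto 2024 Def. 3.8 at `v` for `𝓖 = 𝓕̄`, `w` the Weil self-duality (H.SD) of `T̄ = E[n]`).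
Proof: `y ∈ w⁻¹(𝓖_v^*)` pairs to zero with `𝓖_v ⊇ 𝓛_v` under `inv_v(· ∪ₑ y)`
(`mem_dualTransported_weilDual_iff`), hence `a ∪ₑ y = 0` for all `a ∈ 𝓛_v` (`inv_v` injective),
hence `y ∈ 𝓛_v ≤ 𝓖_v` by the right maximal isotropy of `𝓛_v`
(`forall_mem_kummerSelmerStructure_weilCupProduct_eq_zero_right_iff_inr_of_localEuler`).  No
Tamagawa-number / reduction / local-torsion hypothesis (contrast Sakamoto's Lemma 9.3 for the
unramified conditions of his Def. 9.2).  This is skeleton T-a3 v2 §6 (a) in the kernel.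
[cite: Sakamoto2024, Def. 3.8 (p. 924) and Thm. 4.4 (p. 926)]
[cite: MilneADT2006, Ch. I, Cor. 3.4 and Lemma 6.15] -/
theorem isResiduallyCoisotropicAt_inr_of_kummer_le
    (halt : ∀ T, e T T = 1) (hnondeg : ∀ T, (∀ S, e S T = 1) → T = 0) (hn : IsPrimePow n)
    (v : HeightOneSpectrum (𝓞 K)) (hEP : localEulerPoincareCharacteristic (v.adicCompletion K))
    (inv : LocalInvariants K n) (hinv : Injective (inv (Sum.inr v)))
    (𝓖 : SelmerStructure (W.torsionGaloisModule n))
    (h𝓖 : W.kummerSelmerStructure n (Sum.inr v) ≤ 𝓖 (Sum.inr v)) :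
    inv.IsResiduallyCoisotropicAt 𝓖 (weilDualIntertwining W n e hμ hadd₁ hadd₂ hgal) (Sum.inr v) := by
  intro y hy
  rw [mem_dualTransported_weilDual_iff] at hy
  refine h𝓖 ((forall_mem_kummerSelmerStructure_weilCupProduct_eq_zero_right_iff_inr_of_localEuler
    W n e hμ hadd₁ hadd₂ hgal halt hnondeg hn v hEP y).mp fun x hx => ?_)
  exact hinv ((hy x (h𝓖 hx)).trans (map_zero _).symm)

/-- **At an infinite place and odd `n` every local condition on `E[n]` is residually coisotropic**,
for every family `inv` and every transport map: `H¹(K_w, E[n]) = 0` (`Γ_{K_w}` has order `≤ 2`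
and the group is killed by the odd `n`; tree
`galoisCohomology_one_torsion_eq_zero_infinitePlace_of_odd`, Milne I Rem. 3.7), so the transported
dual condition is `0 ≤ 𝓖_w`. [cite: Sakamoto2024, Def. 3.8 (p. 924)] [cite: MilneADT2006, I Rem. 3.7] -/
theorem isResiduallyCoisotropicAt_inl_of_odd (hodd : Odd n) (inv : LocalInvariants K n)
    (θ : (W.torsionGaloisModule n).toContRepresentation →ⁱL
      ((W.torsionGaloisModule n).tateDual n).toContRepresentation)
    (𝓖 : SelmerStructure (W.torsionGaloisModule n)) (w : InfinitePlace K) :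
    inv.IsResiduallyCoisotropicAt 𝓖 θ (Sum.inl w) := by
  intro y _
  have hy : y = 0 :=
    galoisCohomology_one_torsion_eq_zero_infinitePlace_of_odd W w ((Int.odd_coe_nat n).mpr hodd) y
  rw [hy]
  exact zero_mem _

/-- **Residual coisotropy on any finite set of places** (Sakamoto 2024 Def. 3.8, the hypothesis
"`𝓕` is residually coisotropic" of Thm. 4.4, for `𝓖 = 𝓕̄` on `T̄ = E[n]` and the Weil
self-duality): if `n` is an ODD prime power, `inv` is a local Tate duality at the finite places
(`LocalInvariants.IsPerfect`, as provided by the tree's fact `poitouTate_selmerStructure_duality`),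
the local Euler–Poincaré characteristic formula holds at the finite places of `S`, and the local
condition `𝓖_v` contains the local Kummer condition at every finite `v ∈ S`, then
`inv.IsResiduallyCoisotropic 𝓖 w S`. [cite: Sakamoto2024, Def. 3.8 (p. 924) and Thm. 4.4 (p. 926)] -/
theorem isResiduallyCoisotropic_of_kummer_le
    (halt : ∀ T, e T T = 1) (hnondeg : ∀ T, (∀ S, e S T = 1) → T = 0) (hn : IsPrimePow n)
    (hodd : Odd n) (inv : LocalInvariants K n) (hinv : inv.IsPerfect) (S : Finset (Place K))
    (hEP : ∀ v : HeightOneSpectrum (𝓞 K), (Sum.inr v : Place K) ∈ S →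
      localEulerPoincareCharacteristic (v.adicCompletion K))
    (𝓖 : SelmerStructure (W.torsionGaloisModule n))
    (h𝓖 : ∀ v : HeightOneSpectrum (𝓞 K), (Sum.inr v : Place K) ∈ S →
      W.kummerSelmerStructure n (Sum.inr v) ≤ 𝓖 (Sum.inr v)) :
    inv.IsResiduallyCoisotropic 𝓖 (weilDualIntertwining W n e hμ hadd₁ hadd₂ hgal) S := by
  intro v hv
  cases v with
  | inl w => exact isResiduallyCoisotropicAt_inl_of_odd W n hodd inv _ 𝓖 w
  | inr v =>
    exact isResiduallyCoisotropicAt_inr_of_kummer_le W n e hμ hadd₁ hadd₂ hgal halt hnondeg hn v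
      (hEP v hv) inv (hinv v).1.injective 𝓖 (h𝓖 v hv)

/-- Variant with the Euler characteristic assumed at every finite place and the Kummer containment
at every finite place (the form in which a consumer working with `S ⊇ S(𝓕)` unspecified uses it).
[cite: Sakamoto2024, Def. 3.8 (p. 924)] -/
theorem isResiduallyCoisotropic_of_kummer_le'
    (halt : ∀ T, e T T = 1) (hnondeg : ∀ T, (∀ S, e S T = 1) → T = 0) (hn : IsPrimePow n)
    (hodd : Odd n) (inv : LocalInvariants K n) (hinv : inv.IsPerfect)
    (hEP : ∀ v : HeightOneSpectrum (𝓞 K), localEulerPoincareCharacteristic (v.adicCompletion K))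
    (𝓖 : SelmerStructure (W.torsionGaloisModule n))
    (h𝓖 : ∀ v : HeightOneSpectrum (𝓞 K), W.kummerSelmerStructure n (Sum.inr v) ≤ 𝓖 (Sum.inr v))
    (S : Finset (Place K)) :
    inv.IsResiduallyCoisotropic 𝓖 (weilDualIntertwining W n e hμ hadd₁ hadd₂ hgal) S :=
  isResiduallyCoisotropic_of_kummer_le W n e hμ hadd₁ hadd₂ hgal halt hnondeg hn hodd inv hinv S
    (fun v _ => hEP v) 𝓖 fun v _ => h𝓖 v

/-! ### The classical structure on `E[n]` is residually self-dual at the finite places -/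

/-- **`w⁻¹(𝓛_v^*) = 𝓛_v` at a finite place**: the transported dual of the Kummer condition on
`E[n]` is the Kummer condition (`inv_v` injective, `n` a prime power, Euler characteristic at `v`)
— the local Kummer condition is its own annihilator under `inv_v(· ∪ₑ ·)` (right maximal
isotropy).  So the classical (Kummer) structure on `T̄ = E[n]` is residually SELF-dual at every
finite place: no finite place is exceptional for it (Sakamoto Def. 3.9).  Tate local duality for
`E`, Milne I Cor. 3.4. [cite: Sakamoto2024, Def. 3.8 and Def. 3.9 (p. 924)]
[cite: MilneADT2006, Ch. I, Cor. 3.4] -/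
theorem dualTransported_kummerSelmerStructure_inr
    (halt : ∀ T, e T T = 1) (hnondeg : ∀ T, (∀ S, e S T = 1) → T = 0) (hn : IsPrimePow n)
    (v : HeightOneSpectrum (𝓞 K)) (hEP : localEulerPoincareCharacteristic (v.adicCompletion K))
    (inv : LocalInvariants K n) (hinv : Injective (inv (Sum.inr v))) :
    inv.dualTransported (W.kummerSelmerStructure n) (weilDualIntertwining W n e hμ hadd₁ hadd₂ hgal)
        (Sum.inr v) = W.kummerSelmerStructure n (Sum.inr v) := by
  ext y
  rw [mem_dualTransported_weilDual_iff,
    ← forall_mem_kummerSelmerStructure_weilCupProduct_eq_zero_right_iff_inr_of_localEuler W n e hμ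
      hadd₁ hadd₂ hgal halt hnondeg hn v hEP y]
  exact forall₂_congr fun x _ =>
    ⟨fun h => hinv (h.trans (map_zero _).symm), fun h => (congrArg (inv _) h).trans (map_zero _)⟩

end NumberField

end Summit.BirchSwinnertonDyer.Rank1Residual.GaloisImage

end
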